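import Summits.FinalStateConjecture.FinalStateConjecture.Theorems.ClusterCompletenessAdiabaticMultiKerrILEDSlabIdentity

/-!
# Crux `AdiabaticMultiKerrILED` (line `Sketch`) — the nonnegative part of an `L¹` current's divergence

Helper file for the crux `stmt-FinalStateConjecture-14310`
(`Summit.FinalStateConjecture.FinalStateConjecture.Theses.ClusterCompleteness.AdiabaticMultiKerrILED`),
far-field stub `stub_farTransport`: the Morawetz bulk `ζ B ≥ 0` is not known to be integrable a
priori, so the slab identity of `…SlabIdentity.lean` is re-run with monotone convergence:

* `lintegral_nonneg_divergence_le` — if `∑_μ ∂_μ J^μ = P + Q` on the slab with `P ≥ 0` continuous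
  and `Q` integrable, `J^μ` integrable on the slab and `J⁰` on the boundary slices, then
  `∫∫_{slab} P ≤ ‖J⁰(t₁,·)‖_{L¹} + ‖J⁰(t₀,·)‖_{L¹} + ‖Q‖_{L¹(slab)}` (so `P` is integrable). [folklore]
-/

noncomputable section

-- the doubled `FinalStateConjecture.FinalStateConjecture` path component trips dupNamespace
set_option linter.dupNamespace false

open scoped ContDiff Topology
open Filter Set MeasureTheory Literature.Geometry.Lorentzian

namespace Summit.FinalStateConjecture.FinalStateConjecture.Cruxes.AdiabaticMultiKerrILED.Sketch

/-! ### The nonnegative part of the divergence is bounded by the boundary and error terms -/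

/-- The cut-offs increase with `n`: `f_n ≤ f_{n+1}` pointwise. [folklore] -/
theorem spatialCutoff_mono (x : E4) :
    Monotone fun n : ℕ ↦ Real.smoothTransition (2 - E4.spatialNorm x ^ 2 / ((n : ℝ) + 1) ^ 2) := by
  refine monotone_nat_of_le_succ fun n ↦ Real.smoothTransition.monotone ?_
  have h0 : (0 : ℝ) < (n : ℝ) + 1 := by positivity
  have h1 : ((n : ℝ) + 1) ^ 2 ≤ ((n + 1 : ℕ) + 1 : ℝ) ^ 2 := by
    push_cast; nlinarith
  have hs := sq_nonneg (E4.spatialNorm x)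
  have : E4.spatialNorm x ^ 2 / (((n + 1 : ℕ) : ℝ) + 1) ^ 2 ≤ E4.spatialNorm x ^ 2 / ((n : ℝ) + 1) ^ 2 :=
    div_le_div_of_nonneg_left hs (by positivity) h1
  linarith

/-- **The nonnegative part of the divergence of an `L¹` current is controlled by the boundary slices
and the integrable part.** Let `J` be a `C¹` current on `ℝ⁴` whose components are integrable on the slab
`(t₀, t₁] × ℝ³` and whose time component is integrable on the two boundary slices, and suppose
`∑_μ ∂_μ J^μ = P + Q` on `{t₀ ≤ t ≤ t₁}` with `P ≥ 0` continuous and `Q` continuous and integrable on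
the slab. Then `∫∫_{slab} P ≤ ‖J⁰(t₁,·)‖_{L¹} + ‖J⁰(t₀,·)‖_{L¹} + ‖Q‖_{L¹(slab)}` (in particular `P`
is integrable): the compact-support identity for `f_n J`, `|f_n| ≤ 1`, `‖df_n‖ ≤ C/n`, and monotone
convergence in `n`. [folklore] -/
theorem lintegral_nonneg_divergence_le :
    ∀ (J : Fin 4 → E4 → ℝ) (P Q : E4 → ℝ) (t₀ t₁ : ℝ), t₀ ≤ t₁ → (∀ μ, ContDiff ℝ 1 (J μ)) →
      Continuous P → (∀ x, 0 ≤ P x) → Continuous Q →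
      (∀ x : E4, t₀ ≤ x 0 → x 0 ≤ t₁ →
        ∑ μ, fderiv ℝ (J μ) x (E4.basisVector μ) = P x + Q x) →
      Integrable (fun y : E3 ↦ J 0 (E4.ofTimeSpace t₀ y)) →
      Integrable (fun y : E3 ↦ J 0 (E4.ofTimeSpace t₁ y)) →
      (∀ μ, Integrable (fun q : ℝ × E3 ↦ J μ (E4.ofTimeSpace q.1 q.2))
        ((volume.restrict (Ioc t₀ t₁)).prod volume)) →
      Integrable (fun q : ℝ × E3 ↦ Q (E4.ofTimeSpace q.1 q.2))
        ((volume.restrict (Ioc t₀ t₁)).prod volume) →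
      ∫⁻ q, ENNReal.ofReal (P (E4.ofTimeSpace q.1 q.2)) ∂((volume.restrict (Ioc t₀ t₁)).prod volume) ≤
        ENNReal.ofReal ((∫ y, |J 0 (E4.ofTimeSpace t₁ y)|) + (∫ y, |J 0 (E4.ofTimeSpace t₀ y)|) +
          ∫ q, |Q (E4.ofTimeSpace q.1 q.2)| ∂((volume.restrict (Ioc t₀ t₁)).prod volume)) := by
  intro J P Q t₀ t₁ h01 hJ1 hPc hP0 hQc hdivPQ hint₀ hint₁ hslab hQint
  -- notation (as in `slab_identity_of_integrable`)
  obtain ⟨C, hC0, hC⟩ := exists_abs_deriv_smoothTransition_le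
  set μP : Measure (ℝ × E3) := (volume.restrict (Ioc t₀ t₁)).prod volume with hμP
  set f : ℕ → E4 → ℝ := fun n x ↦ Real.smoothTransition (2 - E4.spatialNorm x ^ 2 / ((n : ℝ) + 1) ^ 2)
    with hf
  have hμPr : μP = (volume.prod volume).restrict (Ioc t₀ t₁ ×ˢ (univ : Set E3)) := by
    rw [hμP]
    conv_lhs => rw [← Measure.restrict_univ (μ := (volume : Measure E3))]
    rw [Measure.prod_restrict]
  have hn1 : ∀ n : ℕ, (1 : ℝ) ≤ (n : ℝ) + 1 := fun n ↦ by
    have := (Nat.cast_nonneg n : (0 : ℝ) ≤ n); linarith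
  have hnpos : ∀ n : ℕ, (0 : ℝ) < (n : ℝ) + 1 := fun n ↦ by linarith [hn1 n]
  have hf1 : ∀ n, ContDiff ℝ 1 (f n) := fun n ↦ contDiff_spatialCutoff _
  have hf01 : ∀ n x, 0 ≤ f n x ∧ f n x ≤ 1 := fun n x ↦ spatialCutoff_mem _ x
  have hfabs : ∀ n x, |f n x| ≤ 1 := fun n x ↦ by
    rw [abs_of_nonneg (hf01 n x).1]; exact (hf01 n x).2
  have hdf : ∀ n x μ, |fderiv ℝ (f n) x (E4.basisVector μ)| ≤ 4 * C / ((n : ℝ) + 1) :=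
    fun n x μ ↦ abs_fderiv_spatialCutoff_le hC0 hC (hn1 n) x μ
  have hdf' : ∀ n x μ, |fderiv ℝ (f n) x (E4.basisVector μ)| ≤ 4 * C := fun n x μ ↦
    (hdf n x μ).trans (div_le_self (by positivity) (hn1 n))
  have hJd : ∀ μ x, DifferentiableAt ℝ (J μ) x := fun μ x ↦ (hJ1 μ).differentiable one_ne_zero x
  have hfd : ∀ n x, DifferentiableAt ℝ (f n) x := fun n x ↦ (hf1 n).differentiable one_ne_zero x
  set Jn : ℕ → Fin 4 → E4 → ℝ := fun n μ x ↦ f n x * J μ x with hJn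
  have hJn1 : ∀ n μ, ContDiff ℝ 1 (Jn n μ) := fun n μ ↦ (hf1 n).mul (hJ1 μ)
  have hdivJn : ∀ n x, ∑ μ, fderiv ℝ (Jn n μ) x (E4.basisVector μ) =
      f n x * (∑ μ, fderiv ℝ (J μ) x (E4.basisVector μ)) +
        ∑ μ, fderiv ℝ (f n) x (E4.basisVector μ) * J μ x := by
    intro n x
    rw [Finset.mul_sum, ← Finset.sum_add_distrib]
    refine Finset.sum_congr rfl fun μ _ ↦ ?_
    have h' : HasFDerivAt (fun y ↦ f n y * J μ y)
        (f n x • fderiv ℝ (J μ) x + J μ x • fderiv ℝ (f n) x) x :=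
      (hfd n x).hasFDerivAt.mul (hJd μ x).hasFDerivAt
    simp only [hJn]
    rw [h'.fderiv]
    simp only [add_apply, smul_apply, smul_eq_mul]
    ring
  have hEn : ∀ n : ℕ, (∫ y, Jn n 0 (E4.ofTimeSpace t₁ y)) - ∫ y, Jn n 0 (E4.ofTimeSpace t₀ y) =
      ∫ t in Ioc t₀ t₁, ∫ y, ∑ μ, fderiv ℝ (Jn n μ) (E4.ofTimeSpace t y) (E4.basisVector μ) := by
    intro n
    refine E4.integral_sub_eq_integral_divergence (hJn1 n) (ρ := 2 * ((n : ℝ) + 1)) h01 ?_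
    intro μ t _ y hy
    simp only [hJn, hf]
    rw [spatialCutoff_eq_zero (hnpos n) (by rw [E4.spatialNorm_ofTimeSpace]; exact hy.le), zero_mul]
  have hcts : Continuous fun q : ℝ × E3 ↦ E4.ofTimeSpace q.1 q.2 := E4.continuous_ofTimeSpace_uncurry
  have hfc : ∀ n, Continuous fun q : ℝ × E3 ↦ f n (E4.ofTimeSpace q.1 q.2) := fun n ↦
    (hf1 n).continuous.comp hcts
  have hdfc : ∀ n μ, Continuous fun q : ℝ × E3 ↦ fderiv ℝ (f n) (E4.ofTimeSpace q.1 q.2) (E4.basisVector μ) :=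
    fun n μ ↦ (((hf1 n).continuous_fderiv one_ne_zero).comp hcts).clm_apply continuous_const
  -- the three integrable pieces: `f_n Q`, the layer `R_n`, and `f_n P` (bounded with bounded support)
  set Rn : ℕ → ℝ × E3 → ℝ := fun n q ↦
    ∑ μ, fderiv ℝ (f n) (E4.ofTimeSpace q.1 q.2) (E4.basisVector μ) * J μ (E4.ofTimeSpace q.1 q.2) with hRn
  have hRn_int : ∀ n, Integrable (Rn n) μP := fun n ↦ by
    refine integrable_finsetSum _ fun μ _ ↦ ?_
    exact (hslab μ).bdd_mul (c := 4 * C) (hdfc n μ).aestronglyMeasurable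
      (Eventually.of_forall fun q ↦ by rw [Real.norm_eq_abs]; exact hdf' n _ μ)
  have hfQ_int : ∀ n, Integrable (fun q : ℝ × E3 ↦ f n (E4.ofTimeSpace q.1 q.2) * Q (E4.ofTimeSpace q.1 q.2)) μP :=
    fun n ↦ hQint.bdd_mul (c := 1) (hfc n).aestronglyMeasurable
      (Eventually.of_forall fun q ↦ by rw [Real.norm_eq_abs]; exact hfabs n _)
  set Fn : ℕ → ℝ × E3 → ℝ := fun n q ↦ f n (E4.ofTimeSpace q.1 q.2) * P (E4.ofTimeSpace q.1 q.2) with hFn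
  have hFnc : ∀ n, Continuous (Fn n) := fun n ↦ (hfc n).mul (hPc.comp hcts)
  have hFn_nn : ∀ n q, 0 ≤ Fn n q := fun n q ↦ mul_nonneg (hf01 n _).1 (hP0 _)
  have hFn_int : ∀ n, Integrable (Fn n) μP := by
    intro n
    -- `Fn n` vanishes for `‖y‖ ≥ 2(n+1)` and is continuous: integrable on the compact cylinder
    set K : Set (ℝ × E3) := Icc t₀ t₁ ×ˢ Metric.closedBall (0 : E3) (2 * ((n : ℝ) + 1)) with hK
    have hKc : IsCompact K := isCompact_Icc.prod (isCompact_closedBall _ _)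
    have hIK : IntegrableOn (Fn n) K (volume.prod volume) :=
      (hFnc n).continuousOn.integrableOn_compact hKc
    have hzero : ∀ q : ℝ × E3, q ∈ Ioc t₀ t₁ ×ˢ (univ : Set E3) → q ∉ K → Fn n q = 0 := by
      intro q hq hqK
      simp only [hK, mem_prod, mem_Icc, Metric.mem_closedBall, dist_zero_right, not_and, not_le] at hqK
      have hy : 2 * ((n : ℝ) + 1) < ‖q.2‖ := hqK ⟨hq.1.1.le, hq.1.2⟩
      simp only [hFn, hf]
      rw [spatialCutoff_eq_zero (hnpos n) (by rw [E4.spatialNorm_ofTimeSpace]; exact hy.le), zero_mul]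
    have hIon : IntegrableOn (Fn n) (Ioc t₀ t₁ ×ˢ (univ : Set E3)) (volume.prod volume) := by
      have hsplit : Ioc t₀ t₁ ×ˢ (univ : Set E3) =
          (Ioc t₀ t₁ ×ˢ (univ : Set E3)) ∩ K ∪ (Ioc t₀ t₁ ×ˢ (univ : Set E3)) \ K := by
        rw [inter_union_sdiff]
      rw [hsplit]
      refine IntegrableOn.union (hIK.mono_set inter_subset_right) ?_
      refine (integrableOn_congr_fun (fun q hq ↦ hzero q hq.1 hq.2) ?_).mpr integrableOn_zero
      exact (measurableSet_Ioc.prod MeasurableSet.univ).diff hKc.isClosed.measurableSet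
    rw [hμPr]
    exact hIon
  -- on the slab, `f_n P = div J_n − f_n Q − R_n`
  have hae : ∀ n, (Fn n) =ᵐ[μP] fun q ↦
      (∑ μ, fderiv ℝ (Jn n μ) (E4.ofTimeSpace q.1 q.2) (E4.basisVector μ)) -
        f n (E4.ofTimeSpace q.1 q.2) * Q (E4.ofTimeSpace q.1 q.2) - Rn n q := by
    intro n
    have hmem : ∀ᵐ q : ℝ × E3 ∂μP, q.1 ∈ Ioc t₀ t₁ := by
      rw [hμPr]
      filter_upwards [ae_restrict_mem (measurableSet_Ioc.prod MeasurableSet.univ)] with q hq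
      exact hq.1
    filter_upwards [hmem] with q hq
    simp only [hFn, hRn]
    rw [hdivJn, hdivPQ _ (by simpa using hq.1.le) (by simpa using hq.2)]
    ring
  have hdivJn_int : ∀ n, Integrable (fun q : ℝ × E3 ↦
      ∑ μ, fderiv ℝ (Jn n μ) (E4.ofTimeSpace q.1 q.2) (E4.basisVector μ)) μP := by
    intro n
    have h : (fun q : ℝ × E3 ↦ ∑ μ, fderiv ℝ (Jn n μ) (E4.ofTimeSpace q.1 q.2) (E4.basisVector μ)) =ᵐ[μP]
        fun q ↦ Fn n q + f n (E4.ofTimeSpace q.1 q.2) * Q (E4.ofTimeSpace q.1 q.2) + Rn n q := by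
      filter_upwards [hae n] with q hq
      rw [hq]; ring
    exact ((((hFn_int n).add (hfQ_int n)).add (hRn_int n)).congr h.symm)
  -- the real-valued bound for each `n`
  set B : ℝ := (∫ y, |J 0 (E4.ofTimeSpace t₁ y)|) + (∫ y, |J 0 (E4.ofTimeSpace t₀ y)|) +
    ∫ q, |Q (E4.ofTimeSpace q.1 q.2)| ∂μP with hB
  set KJ : ℝ := ∑ μ, ∫ q, |J μ (E4.ofTimeSpace q.1 q.2)| ∂μP with hKJ
  have hbound : ∀ n, ∫ q, Fn n q ∂μP ≤ B + 4 * C * KJ / ((n : ℝ) + 1) := by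
    intro n
    have h1 : ∫ q, Fn n q ∂μP = (∫ q, ∑ μ, fderiv ℝ (Jn n μ) (E4.ofTimeSpace q.1 q.2) (E4.basisVector μ) ∂μP) -
        (∫ q, f n (E4.ofTimeSpace q.1 q.2) * Q (E4.ofTimeSpace q.1 q.2) ∂μP) - ∫ q, Rn n q ∂μP := by
      have hAB : Integrable (fun q : ℝ × E3 ↦
          (∑ μ, fderiv ℝ (Jn n μ) (E4.ofTimeSpace q.1 q.2) (E4.basisVector μ)) -
            f n (E4.ofTimeSpace q.1 q.2) * Q (E4.ofTimeSpace q.1 q.2)) μP :=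
        (hdivJn_int n).sub (hfQ_int n)
      rw [integral_congr_ae (hae n), integral_sub hAB (hRn_int n),
        integral_sub (hdivJn_int n) (hfQ_int n)]
    have h2 : (∫ q, ∑ μ, fderiv ℝ (Jn n μ) (E4.ofTimeSpace q.1 q.2) (E4.basisVector μ) ∂μP) =
        (∫ y, Jn n 0 (E4.ofTimeSpace t₁ y)) - ∫ y, Jn n 0 (E4.ofTimeSpace t₀ y) := by
      rw [hEn n]
      exact integral_prod _ (hdivJn_int n)
    -- boundary slices
    have hsl : ∀ t, Integrable (fun y : E3 ↦ J 0 (E4.ofTimeSpace t y)) →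
        |∫ y, Jn n 0 (E4.ofTimeSpace t y)| ≤ ∫ y, |J 0 (E4.ofTimeSpace t y)| := by
      intro t hint
      calc |∫ y, Jn n 0 (E4.ofTimeSpace t y)| ≤ ∫ y, |Jn n 0 (E4.ofTimeSpace t y)| :=
            abs_integral_le_integral_abs
        _ ≤ ∫ y, |J 0 (E4.ofTimeSpace t y)| := by
            refine integral_mono ?_ hint.abs fun y ↦ ?_
            · exact (hint.bdd_mul (c := 1) (((hf1 n).continuous.comp (E4.continuous_ofTimeSpace t)).aestronglyMeasurable)
                (Eventually.of_forall fun y ↦ by rw [Real.norm_eq_abs]; exact hfabs n _)).abs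
            · simp only [hJn, abs_mul]
              exact mul_le_of_le_one_left (abs_nonneg _) (hfabs n _)
    -- the `Q` term and the layer
    have hQb : |∫ q, f n (E4.ofTimeSpace q.1 q.2) * Q (E4.ofTimeSpace q.1 q.2) ∂μP| ≤
        ∫ q, |Q (E4.ofTimeSpace q.1 q.2)| ∂μP := by
      calc |∫ q, f n (E4.ofTimeSpace q.1 q.2) * Q (E4.ofTimeSpace q.1 q.2) ∂μP|
          ≤ ∫ q, |f n (E4.ofTimeSpace q.1 q.2) * Q (E4.ofTimeSpace q.1 q.2)| ∂μP := abs_integral_le_integral_abs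
        _ ≤ ∫ q, |Q (E4.ofTimeSpace q.1 q.2)| ∂μP := by
            refine integral_mono (hfQ_int n).abs hQint.abs fun q ↦ ?_
            simp only [abs_mul]
            exact mul_le_of_le_one_left (abs_nonneg _) (hfabs n _)
    have hRb : |∫ q, Rn n q ∂μP| ≤ 4 * C * KJ / ((n : ℝ) + 1) := by
      calc |∫ q, Rn n q ∂μP| ≤ ∫ q, |Rn n q| ∂μP := abs_integral_le_integral_abs
        _ ≤ ∫ q, (4 * C / ((n : ℝ) + 1)) * ∑ μ, |J μ (E4.ofTimeSpace q.1 q.2)| ∂μP := by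
            refine integral_mono (hRn_int n).abs ?_ fun q ↦ ?_
            · exact (integrable_finsetSum _ fun μ _ ↦ (hslab μ).abs).const_mul _
            · rw [hRn, Finset.mul_sum]
              refine (Finset.abs_sum_le_sum_abs _ _).trans (Finset.sum_le_sum fun μ _ ↦ ?_)
              rw [abs_mul]
              exact mul_le_mul_of_nonneg_right (hdf n _ μ) (abs_nonneg _)
        _ = 4 * C * KJ / ((n : ℝ) + 1) := by
            rw [integral_const_mul, integral_finsetSum _ fun μ _ ↦ (hslab μ).abs, hKJ]
            ring
    rw [h1, h2, hB]
    have e1 := hsl t₁ hint₁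
    have e0 := hsl t₀ hint₀
    rw [abs_le] at e1 e0 hQb hRb
    linarith [e1.1, e1.2, e0.1, e0.2, hQb.1, hQb.2, hRb.1, hRb.2]
  -- monotone convergence in `n`
  have hmeasP : Measurable fun q : ℝ × E3 ↦ ENNReal.ofReal (P (E4.ofTimeSpace q.1 q.2)) :=
    ENNReal.measurable_ofReal.comp (hPc.comp hcts).measurable
  have hmeasFn : ∀ n, Measurable fun q : ℝ × E3 ↦ ENNReal.ofReal (Fn n q) := fun n ↦
    ENNReal.measurable_ofReal.comp (hFnc n).measurable
  have hmono : Monotone fun n q ↦ ENNReal.ofReal (Fn n q) := by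
    intro n m hnm q
    refine ENNReal.ofReal_le_ofReal (mul_le_mul_of_nonneg_right ?_ (hP0 _))
    exact spatialCutoff_mono _ hnm
  have hsup : (fun q : ℝ × E3 ↦ ENNReal.ofReal (P (E4.ofTimeSpace q.1 q.2))) =
      fun q ↦ ⨆ n, ENNReal.ofReal (Fn n q) := by
    funext q
    have htend : Tendsto (fun n ↦ ENNReal.ofReal (Fn n q)) atTop
        (𝓝 (ENNReal.ofReal (P (E4.ofTimeSpace q.1 q.2)))) := by
      apply tendsto_const_nhds.congr'
      filter_upwards [eventually_ge_atTop ⌈‖q.2‖⌉₊] with n hn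
      simp only [hFn, hf]
      rw [spatialCutoff_eq_one (hnpos n), one_mul]
      rw [E4.spatialNorm_ofTimeSpace]
      have : (⌈‖q.2‖⌉₊ : ℝ) ≤ n := by exact_mod_cast hn
      linarith [Nat.le_ceil ‖q.2‖]
    exact tendsto_nhds_unique htend (tendsto_atTop_iSup fun n m hnm ↦ hmono hnm q)
  rw [hsup, lintegral_iSup hmeasFn hmono]
  -- each term is `ofReal (∫ Fn n)` and the bounds tend to `ofReal B`
  have hterm : ∀ n, ∫⁻ q, ENNReal.ofReal (Fn n q) ∂μP ≤ ENNReal.ofReal (B + 4 * C * KJ / ((n : ℝ) + 1)) := by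
    intro n
    rw [← ofReal_integral_eq_lintegral_ofReal (hFn_int n) (Eventually.of_forall (hFn_nn n))]
    exact ENNReal.ofReal_le_ofReal (hbound n)
  have hlim : Tendsto (fun n : ℕ ↦ ENNReal.ofReal (B + 4 * C * KJ / ((n : ℝ) + 1))) atTop
      (𝓝 (ENNReal.ofReal B)) := by
    refine ENNReal.tendsto_ofReal ?_
    have h := tendsto_const_div_atTop_nhds_zero_nat (4 * C * KJ)
    have h' : Tendsto (fun n : ℕ ↦ 4 * C * KJ / ((n + 1 : ℕ) : ℝ)) atTop (𝓝 0) :=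
      h.comp (tendsto_add_atTop_nat 1)
    have h'' : Tendsto (fun n : ℕ ↦ B + 4 * C * KJ / ((n : ℝ) + 1)) atTop (𝓝 (B + 0)) := by
      refine (tendsto_const_nhds.add h').congr fun n ↦ ?_
      push_cast; ring
    rwa [add_zero] at h''
  have hconv : Tendsto (fun n ↦ ∫⁻ q, ENNReal.ofReal (Fn n q) ∂μP) atTop
      (𝓝 (⨆ n, ∫⁻ q, ENNReal.ofReal (Fn n q) ∂μP)) :=
    tendsto_atTop_iSup fun n m hnm ↦ lintegral_mono fun q ↦ hmono hnm q
  exact le_of_tendsto_of_tendsto' hconv hlim hterm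

end Summit.FinalStateConjecture.FinalStateConjecture.Cruxes.AdiabaticMultiKerrILED.Sketch

end
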